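import Mathlib
import Literature.Analysis.OperatorTheory.HilbertInequality
import Literature.LinearAlgebra.Matrix.HermitianCfcDiagonalForm
import Literature.MathematicalPhysics.QuantumFieldTheory.Balaban1983to89.B9SectEKernel
import HarnessLib

/-! # `Balaban1983to89.B13Sqrt27` — [Balaban1988RG2Cluster] display (2.7) p. 13: the resolvent-integral /
power-series representation of `(C^{(k)})^{1/2} = (C*Δ_kC)^{−1/2}` KERNEL-CHECKED (scalar and, entrywise, for a
positive definite real symmetric matrix), the print slip in its series term REFUTED, and the decay of the
square-root kernel DERIVED from the tree's `x`-uniform resolvent decay; the by-assertion input after (2.7)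
LOCATED on the compact range `x ∈ [0, γ₁]`

CITATION HEADER (lean-in-tree rule 2026-08-18).  Source: T. Bałaban, *Renormalization group approach to lattice
gauge field theories. II. Cluster expansions*, Commun. Math. Phys. **116**, 1–22 (1988) [`Balaban1988RG2Cluster`]
(cell paper B13; held: `paper:balaban1988-cmp116-rg-ii-cluster`, journal page = PDF page; quotations read from the
page renders `b2b-balaban-ref1/pages/1988-cmp116-rg-II-cluster/1988-cmp116-rg-II-cluster-p013-x2.png`,
`…-p015-x2.png`).  p. 13 [PDF 13], verbatim: *"This construction was discussed in [13] for all operators determining Δ_k, and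
for C^{(k)}(Z₀), but not for (C^{(k)})^{1/2}. To expand the last operator we use a method similar to the method of
Sect. C [16]. There it was applied to expand the determinant of this operator, see (63) [16]. Now we can simplify
it a bit using a better decay property of an underintegral function, and we have*
`(C^{(k)})^{1/2} = (C*Δ_kC)^{−1/2} = (1/π)∫₀^∞ dx x^{−1/2}(xI + C*Δ_kC)^{−1}`
`= (1/π)∫₀^{γ₁} dx x^{−1/2}(xI + C*Δ_kC)^{−1} + Σ_{n=0}^∞ ((−1)^n/(n+1/2)) γ₁^{−n−1/2}(C*Δ_kC)^n.   (2.7)`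
*Expanding the operator Δ_k into the generalized random walks, we obtain an expansion of the series above, if γ₁
is sufficiently large. The resolvent (xI + C*Δ_kC)^{−1} has a representation similar to (C*Δ_kC)^{−1}. More
exactly, the operator C(xI + C*Δ_kC)^{−1}C* is representated by the integral (3.185) [13] with the additional term
−½x‖χ*(QA + D̄μ(QA))‖² under the exponential function … This term determines a nonnegative, bounded and almost
local operator. The integral yields the representation (3.185) [13], with the operator G̃₂ replaced by G̃₃(x),
which is defined as G̃₂, but with this additional operator. The operator G̃₃(x) has the same properties as G̃₂,
especially it can be expanded into a generalized random walk expansion. This yields an expansion of the integral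
above, hence an expansion of (C^{(k)})^{1/2} also."*  p. 15 [PDF 15]: *"For the pair (U,0) the operators are
symmetric, and the measure is positive … The general case is handled by a perturbative argument."*
([13] = B9 [`Balaban1985BackgroundPropagators`], [16] = B10 [`Balaban1985UV3`].)

WHAT IS REPRODUCED (unit `b2b-balaban-b13-g4`; cell GAPS.md G-B13-05 (a), C-adv5-9, C-IF-07, G-IF-10; the
sibling modules `…B13`, `…B13Closing`, `…B9SectEKernel` are NOT modified):
§1 (scalar calculus, `a > 0` playing one eigenvalue of `C*Δ_kC`): with `kernel a x = x^{−1/2}(x + a)^{−1}` and the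
antiderivative `prim a x = (2/√a)·arctan(√x/√a)` (tree: `HilbertInequality.hasDerivAt_arctan_sqrt_div`):
`∫₀^∞ kernel a = π/√a` (`integral_kernel_Ioi`), i.e. the FIRST identity of (2.7) `a^{−1/2} = (1/π)∫₀^∞ …`
(`inv_sqrt_eq_integral`); the tail `∫_{γ₁}^∞ kernel a = (2/√a)·arctan(√a/√γ₁)` (`integral_kernel_tail`) is the
sum of the printed series `Σ_m ((−1)^m/(m+½)) γ₁^{−m−½} a^m` exactly when `a < γ₁` (`hasSum_seriesTerm`, from
Mathlib's `Real.hasSum_arctan`) — this is "γ₁ sufficiently large" made precise: `γ₁ >` every eigenvalue (for the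
entrywise IDENTITY; the threshold for the localised EXPANSION of the series is the residual G-B9-10 / G-B13-05 (a),
cf. §4's `γ₁ > ρ`); hence the
SECOND identity of (2.7) holds WITH the factor `1/π` on the series (`eq27_scalar`) and is FALSE AS PRINTED, the
series term lacking `1/π` (`eq27_as_printed_false`; cell DIVERGENCE D-b13.3, harmless print slip, now a theorem).
§2 (matrix lift, `T : Matrix n n ℝ` positive definite = the symmetric case (U, 0) of p. 15; `T^{−1/2} :=
cfc (t ↦ t^{−1/2}) T`, Mathlib's functional calculus; everything ENTRYWISE, no matrix norm is chosen):
`(xI + T)⁻¹ = cfc (t ↦ (x+t)⁻¹) T` for `x ≥ 0` (`resolvent_eq_cfc`, `resolvent_apply`), `T^{−1/2}·T^{−1/2} = T⁻¹`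
(`invSqrt_mul_self`: the object IS the square root of `C^{(k)} = (C*Δ_kC)⁻¹`); **(2.7) first identity**
`(T^{−1/2})_{ij} = (1/π)∫₀^∞ dx x^{−1/2}((xI + T)⁻¹)_{ij}` (`invSqrt_apply_eq_integral`); **(2.7) second identity**
with the `1/π` restored, for `γ₁ >` all eigenvalues (`hasSum_series_apply`, `invSqrt_apply_eq_split`), and with the
hypothesis in the FORM shape `⟨v,Tv⟩ ≤ c‖v‖², c < γ₁` (`invSqrt_apply_eq_split_of_form_le`) in which the cell's
interface C-IF-07 (E2) supplies `γ₁(d, L)` (`B9SectEKernel.form_sandwich_le`).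
§3 (what (2.7) is FOR, sup-kernel half, kernel-checked): the superposition bound `|(T^{−1/2})_{ij}| ≤ 2√K` whenever
`|((xI + T)⁻¹)_{ij}| ≤ min(K, x⁻¹)` for all `x > 0` (`abs_invSqrt_apply_le`: `min(K, x⁻¹) ≤ 2(x + K⁻¹)⁻¹` and §1 at
`a = K⁻¹`), and its instance `|(T^{−1/2})_{ij}| ≤ 2(γ − ρ)^{−1/2} e^{−κd(i,j)/2}` under the hypotheses of
the tree's `B9SectEKernel.resolvent_decay_uniform` (coercivity `γ`, `(e^{κd} − 1)`-weighted off-diagonal sums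
`≤ ρ < γ`) plus `T.IsHermitian` (needed for `cfc`) — `abs_invSqrt_apply_le_of_decay`, `…_exp`: the square root
of the fluctuation covariance inherits
HALF the decay rate of the resolvent family, with no random-walk expansion needed for this half.
§4 (the SERIES part of (2.7), v2): *"we obtain an expansion of the series above, if γ₁ is sufficiently large"* at the
level of kernels — if the `e^{κd}`-weighted absolute row sums of `T` are `≤ ρ` then `|(T^m)_{ij}| ≤ ρ^m e^{−κd(i,j)}`
(`weightedRowSum_pow_le`, `abs_pow_apply_le_of_weightedRowSum`: the weighted row norm is submultiplicative) and, for
`γ₁ > ρ`, `|Σ_m ((−1)^m/(m+½)) γ₁^{−m−½}(T^m)_{ij}| ≤ 2γ₁^{−1/2}(1 − ρ/γ₁)^{−1} e^{−κd(i,j)}` (`abs_series_apply_le`):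
the series part is localised at the FULL rate, by a geometric series, with no positivity and no random walk.
LOCATED (not typed — under the cell's ABSOLUTE RULE an assertion of the audited paper is never a fact): the
random-walk / (𝐔, 𝐉)-localised expansion of G̃₃(x) *"with the same properties as G̃₂"* = cell GAPS G-IF-10
(refining G-B13-05 (a), G-B10-06 (ii)).  SHARPENING recorded by this file (the paper's own words *"an expansion
of the series above"* / *"an expansion of the integral above"*): by the split (2.7) the resolvent
`(xI + C*Δ_kC)⁻¹`, hence G̃₃(x), is needed ONLY on the compact range `x ∈ [0, γ₁]`, `γ₁ = γ₁(d, L)` of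
C-IF-07 — the power series carries `x > γ₁` and is a series in `C*Δ_kC` itself, expanded through Δ_k's own
random walk (geometrically convergent, ratio `λ_max/γ₁ < 1`, `hasSum_series_apply`; kernel localisation: §4);
so the `x`-uniformity G-IF-10 asks for is over a bounded `x`-vertex `0 ≤ x ≤ γ₁ = O(1)` (B10 (63), p. 272
[PDF 18]: `0 ≤ x ≤ 2γ₁`), not over `x ∈ [0, ∞)` as G-IF-10's parenthesis has it.  NOT treated: the complex-symmetric
operators `C*Δ_k(σ)C` of the general pair (𝐔, 𝐉) (p. 15 "perturbative argument"; GAPS G-B13-05 (b), (c)), B10's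
log-det variant (63), and anything about G̃₂ itself (GAPS G-B9-10).  Value = kernel certificate of a displayed identity + refuted print slip +
derived kernel bounds + located residual, NOT summit progress.  Elementary; the (2.7)-specific statements are
tagged [cite: Balaban1988RG2Cluster, (2.7) p.13], the calculus [folklore].
-/

noncomputable section

open MeasureTheory Set Filter Matrix
open scoped Real Topology

namespace Literature.MathematicalPhysics.QuantumFieldTheory.Balaban1983to89.B13Sqrt27

/-! ## §1. Scalar calculus of (2.7): one eigenvalue `a > 0` -/

section scalar

variable {a γ₁ x : ℝ}

/-- The scalar integrand of (2.7): `kernel a x = x^{−1/2}(x + a)^{−1}` (typed with `Real.sqrt`; at `x ≤ 0` the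
junk value `(√x)⁻¹ = 0` is never integrated over). [cite: Balaban1988RG2Cluster, (2.7) p.13] -/
def kernel (a x : ℝ) : ℝ := (Real.sqrt x)⁻¹ * (x + a)⁻¹

/-- The antiderivative `prim a x = (2/√a)·arctan(√x/√a)` of `kernel a` on `(0, ∞)` (substitution `x = au²`).
[folklore] -/
def prim (a x : ℝ) : ℝ := 2 / Real.sqrt a * Real.arctan (Real.sqrt x / Real.sqrt a)

/-- The `m`-th term of the series PRINTED in (2.7), for the scalar `a` in place of `C*Δ_kC`:
`((−1)^m/(m+½)) γ₁^{−m−1/2} a^m` (no factor `1/π`, exactly as printed). [cite: Balaban1988RG2Cluster, (2.7) p.13] -/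
def seriesTerm (γ₁ a : ℝ) (m : ℕ) : ℝ :=
  (-1) ^ m / ((m : ℝ) + 1 / 2) * (γ₁ ^ m * Real.sqrt γ₁)⁻¹ * a ^ m

/-- `kernel a x = 1/((a + x)√x)` (the shape used in `HilbertInequality`). [folklore] -/
theorem kernel_eq_one_div (a x : ℝ) : kernel a x = 1 / ((a + x) * Real.sqrt x) := by
  rw [kernel, one_div, mul_inv, mul_comm, add_comm]

/-- `kernel a x ≥ 0` for `a, x ≥ 0`. [folklore] -/
theorem kernel_nonneg (ha : 0 ≤ a) (hx : 0 ≤ x) : 0 ≤ kernel a x := by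
  unfold kernel; positivity

/-- `d/dx prim a x = kernel a x` for `a, x > 0`. [folklore] -/
theorem hasDerivAt_prim (ha : 0 < a) (hx : 0 < x) : HasDerivAt (prim a) (kernel a x) x := by
  rw [kernel_eq_one_div]
  exact Literature.Analysis.OperatorTheory.HilbertInequality.hasDerivAt_arctan_sqrt_div ha hx

/-- `prim a 0 = 0`. [folklore] -/
theorem prim_zero (a : ℝ) : prim a 0 = 0 := by simp [prim]

/-- `prim a` is continuous on `ℝ`. [folklore] -/
theorem continuous_prim (a : ℝ) : Continuous (prim a) := by
  unfold prim; fun_prop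

/-- `prim a x → π/√a` as `x → ∞` (`arctan → π/2`). [folklore] -/
theorem tendsto_prim_atTop (ha : 0 < a) : Tendsto (prim a) atTop (𝓝 (π / Real.sqrt a)) := by
  have hsa : 0 < Real.sqrt a := Real.sqrt_pos.2 ha
  have h1 : Tendsto (fun y : ℝ => Real.sqrt y / Real.sqrt a) atTop atTop :=
    Tendsto.atTop_div_const hsa Real.tendsto_sqrt_atTop
  have h2 : Tendsto (fun y : ℝ => Real.arctan (Real.sqrt y / Real.sqrt a)) atTop (𝓝 (π / 2)) :=
    (Real.tendsto_arctan_atTop.mono_right nhdsWithin_le_nhds).comp h1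
  have h3 := h2.const_mul (2 / Real.sqrt a)
  have heq : 2 / Real.sqrt a * (π / 2) = π / Real.sqrt a := by ring
  rw [heq] at h3
  exact h3

/-- `kernel a` is integrable on `(0, ∞)` for `a > 0` (derivative of a bounded monotone function). [folklore] -/
theorem integrableOn_kernel_Ioi (ha : 0 < a) : IntegrableOn (kernel a) (Ioi 0) :=
  integrableOn_Ioi_deriv_of_nonneg (continuous_prim a).continuousWithinAt
    (fun _ hx => hasDerivAt_prim ha hx) (fun _ hx => kernel_nonneg ha.le (le_of_lt hx))
    (tendsto_prim_atTop ha)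

/-- … hence on every `(γ₁, ∞)`, `γ₁ ≥ 0`. [folklore] -/
theorem integrableOn_kernel_Ioi_of_nonneg (ha : 0 < a) (hγ : 0 ≤ γ₁) :
    IntegrableOn (kernel a) (Ioi γ₁) :=
  (integrableOn_kernel_Ioi ha).mono_set (Ioi_subset_Ioi hγ)

/-- `∫₀^∞ x^{−1/2}(x + a)^{−1} dx = π/√a` for `a > 0`. [folklore] -/
theorem integral_kernel_Ioi (ha : 0 < a) : ∫ x in Ioi 0, kernel a x = π / Real.sqrt a := by
  rw [integral_Ioi_of_hasDerivAt_of_tendsto (continuous_prim a).continuousWithinAt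
    (fun _ hx => hasDerivAt_prim ha hx) (integrableOn_kernel_Ioi ha) (tendsto_prim_atTop ha),
    prim_zero, sub_zero]

/-- **(2.7), first identity, scalar form**: `a^{−1/2} = (1/π)∫₀^∞ dx x^{−1/2}(x + a)^{−1}` (`a > 0`).
[cite: Balaban1988RG2Cluster, (2.7) p.13] -/
theorem inv_sqrt_eq_integral (ha : 0 < a) :
    (Real.sqrt a)⁻¹ = π⁻¹ * ∫ x in Ioi 0, kernel a x := by
  rw [integral_kernel_Ioi ha, div_eq_mul_inv, ← mul_assoc, inv_mul_cancel₀ Real.pi_ne_zero,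
    one_mul]

/-- The tail `∫_{γ₁}^∞ kernel a = π/√a − prim a γ₁`. [folklore] -/
theorem integral_kernel_Ioi_eq_sub (ha : 0 < a) (hγ : 0 < γ₁) :
    ∫ x in Ioi γ₁, kernel a x = π / Real.sqrt a - prim a γ₁ :=
  integral_Ioi_of_hasDerivAt_of_tendsto (continuous_prim a).continuousWithinAt
    (fun _ hx => hasDerivAt_prim ha (hγ.trans hx)) (integrableOn_kernel_Ioi_of_nonneg ha hγ.le)
    (tendsto_prim_atTop ha)

/-- The tail in closed form: `∫_{γ₁}^∞ x^{−1/2}(x + a)^{−1} dx = (2/√a)·arctan(√a/√γ₁)`. [folklore] -/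
theorem integral_kernel_tail (ha : 0 < a) (hγ : 0 < γ₁) :
    ∫ x in Ioi γ₁, kernel a x = 2 / Real.sqrt a * Real.arctan (Real.sqrt a / Real.sqrt γ₁) := by
  rw [integral_kernel_Ioi_eq_sub ha hγ, prim]
  have hq : 0 < Real.sqrt γ₁ / Real.sqrt a := div_pos (Real.sqrt_pos.2 hγ) (Real.sqrt_pos.2 ha)
  have h := Real.arctan_inv_of_pos hq
  rw [inv_div] at h
  rw [h]; ring

/-- The tail is positive. [folklore] -/
theorem integral_kernel_tail_pos (ha : 0 < a) (hγ : 0 < γ₁) : 0 < ∫ x in Ioi γ₁, kernel a x := by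
  rw [integral_kernel_tail ha hγ]
  exact mul_pos (div_pos two_pos (Real.sqrt_pos.2 ha))
    (Real.arctan_pos.2 (div_pos (Real.sqrt_pos.2 ha) (Real.sqrt_pos.2 hγ)))

/-- The head `∫_{(0,γ₁]} kernel a = prim a γ₁`. [folklore] -/
theorem integral_kernel_Ioc (ha : 0 < a) (hγ : 0 < γ₁) :
    ∫ x in Ioc 0 γ₁, kernel a x = prim a γ₁ := by
  have hdisj : Disjoint (Ioc (0 : ℝ) γ₁) (Ioi γ₁) :=
    Set.disjoint_left.2 fun y hy hy' => not_lt.2 hy.2 hy'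
  have h := setIntegral_union hdisj measurableSet_Ioi
    ((integrableOn_kernel_Ioi ha).mono_set Ioc_subset_Ioi_self)
    (integrableOn_kernel_Ioi_of_nonneg ha hγ.le)
  rw [Ioc_union_Ioi_eq_Ioi hγ.le, integral_kernel_Ioi ha, integral_kernel_Ioi_eq_sub ha hγ] at h
  linarith

/-- **The series of (2.7), scalar form**: for `0 < a < γ₁` the printed series `Σ_m ((−1)^m/(m+½)) γ₁^{−m−½} a^m`
converges to the TAIL INTEGRAL `∫_{γ₁}^∞ x^{−1/2}(x + a)^{−1} dx` (expand `(x + a)^{−1}` in powers of `a/x`; here via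
the `arctan` series at `√(a/γ₁)`), so it must carry the same factor `1/π` as the integral. "γ₁ sufficiently large"
= `γ₁ > a` (for this scalar/entrywise identity; the threshold for the localised expansion of the series is the
residual G-B9-10 / G-B13-05 (a), cf. §4); for `a ≥ γ₁` the series diverges. [cite: Balaban1988RG2Cluster, (2.7) p.13] -/
theorem hasSum_seriesTerm (ha : 0 < a) (haγ : a < γ₁) :
    HasSum (seriesTerm γ₁ a) (∫ x in Ioi γ₁, kernel a x) := by
  have hγ : 0 < γ₁ := ha.trans haγ
  have hsa : 0 < Real.sqrt a := Real.sqrt_pos.2 ha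
  have hsγ : 0 < Real.sqrt γ₁ := Real.sqrt_pos.2 hγ
  rw [integral_kernel_tail ha hγ]
  have ht1 : ‖Real.sqrt a / Real.sqrt γ₁‖ < 1 := by
    rw [Real.norm_eq_abs, abs_of_pos (div_pos hsa hsγ), div_lt_one hsγ]
    exact Real.sqrt_lt_sqrt ha.le haγ
  have h := (Real.hasSum_arctan ht1).mul_left (2 / Real.sqrt a)
  have heq : seriesTerm γ₁ a = fun m : ℕ =>
      2 / Real.sqrt a * ((-1) ^ m * (Real.sqrt a / Real.sqrt γ₁) ^ (2 * m + 1) / ↑(2 * m + 1)) := by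
    funext m
    rw [seriesTerm, pow_succ, pow_mul, div_pow, Real.sq_sqrt ha.le, Real.sq_sqrt hγ.le, div_pow]
    have hm : (m : ℝ) + 1 / 2 ≠ 0 := by positivity
    have hm' : ((2 * m + 1 : ℕ) : ℝ) = 2 * ((m : ℝ) + 1 / 2) := by push_cast; ring
    rw [hm']
    have hγn : γ₁ ^ m ≠ 0 := pow_ne_zero _ hγ.ne'
    field_simp
  rw [heq]
  exact h

/-- **(2.7), second identity, scalar form, WITH the factor `1/π` restored on the series** (`0 < a < γ₁`):
`a^{−1/2} = (1/π)∫₀^{γ₁} x^{−1/2}(x + a)^{−1} dx + (1/π)Σ_m ((−1)^m/(m+½)) γ₁^{−m−½} a^m`.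
[cite: Balaban1988RG2Cluster, (2.7) p.13] -/
theorem eq27_scalar (ha : 0 < a) (haγ : a < γ₁) :
    (Real.sqrt a)⁻¹ = π⁻¹ * (∫ x in Ioc 0 γ₁, kernel a x) + π⁻¹ * ∑' m, seriesTerm γ₁ a m := by
  have hγ : 0 < γ₁ := ha.trans haγ
  rw [(hasSum_seriesTerm ha haγ).tsum_eq, integral_kernel_Ioc ha hγ, integral_kernel_Ioi_eq_sub ha hγ,
    inv_sqrt_eq_integral ha, integral_kernel_Ioi ha]
  ring

/-- **(2.7) AS PRINTED is false** (the series term lacks `1/π`; cell DIVERGENCE D-b13.3): for every `0 < a < γ₁`,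
`a^{−1/2} ≠ (1/π)∫₀^{γ₁} x^{−1/2}(x + a)^{−1} dx + Σ_m ((−1)^m/(m+½)) γ₁^{−m−½} a^m` (the tail is positive and
`π ≠ 1`).  Harmless for the paper (a constant factor in a term that is bounded anyway), recorded as a theorem.
[cite: Balaban1988RG2Cluster, (2.7) p.13] -/
theorem eq27_as_printed_false (ha : 0 < a) (haγ : a < γ₁) :
    (Real.sqrt a)⁻¹ ≠ π⁻¹ * (∫ x in Ioc 0 γ₁, kernel a x) + ∑' m, seriesTerm γ₁ a m := by
  have hγ : 0 < γ₁ := ha.trans haγ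
  intro h
  rw [eq27_scalar ha haγ, add_right_inj, (hasSum_seriesTerm ha haγ).tsum_eq] at h
  have hS := integral_kernel_tail_pos ha hγ
  have hπ : π⁻¹ < 1 := inv_lt_one_of_one_lt₀ (by linarith [Real.pi_gt_three])
  have : π⁻¹ * (∫ x in Ioi γ₁, kernel a x) < 1 * ∫ x in Ioi γ₁, kernel a x :=
    mul_lt_mul_of_pos_right hπ hS
  rw [one_mul] at this
  exact this.ne h


end scalar

/-! ## Matrix part -/

section matrix

variable {n : Type*} [Fintype n] [DecidableEq n] {T : Matrix n n ℝ}

omit [DecidableEq n] in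
/-- A coercive symmetric real matrix (`γ‖v‖² ≤ ⟨v, Tv⟩`, `γ > 0`) is positive definite. [folklore] -/
theorem posDef_of_coercive (hT : T.IsHermitian) {γ : ℝ} (hγ : 0 < γ) (hc : QGQInverse.Coercive T γ) :
    T.PosDef :=
  Matrix.PosDef.of_dotProduct_mulVec_pos hT fun v hv => by
    have h0 : 0 ≤ v ⬝ᵥ v := by simpa using dotProduct_star_self_nonneg v
    have h1 : 0 < v ⬝ᵥ v :=
      lt_of_le_of_ne h0 (fun h => hv (dotProduct_self_eq_zero.mp h.symm))
    have h2 := hc v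
    rw [star_trivial]
    linarith [mul_pos hγ h1]

/-- The real spectrum of a positive definite real symmetric matrix is positive. [folklore] -/
theorem spectrum_pos (hT : T.PosDef) : ∀ t ∈ spectrum ℝ T, 0 < t := by
  intro t ht
  rw [hT.1.spectrum_real_eq_range_eigenvalues] at ht
  obtain ⟨k, rfl⟩ := ht
  exact hT.eigenvalues_pos k

/-- Entries of a function of a real symmetric matrix in Mathlib's eigenbasis:
`f(T)_{ij} = Σ_k U_{ik} U_{jk} f(λ_k)`, `U = hT.eigenvectorUnitary`, `λ = hT.eigenvalues`. [folklore] -/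
theorem cfc_apply_eq (hT : T.IsHermitian) (f : ℝ → ℝ) (i j : n) :
    cfc f T i j = ∑ k, (hT.eigenvectorUnitary : Matrix n n ℝ) i k *
      (hT.eigenvectorUnitary : Matrix n n ℝ) j k * f (hT.eigenvalues k) := by
  rw [Literature.LinearAlgebra.Matrix.cfc_apply_eq_sum hT.eigenvectorUnitary.2 hT.spectral_theorem
    f i j]
  refine Finset.sum_congr rfl fun k _ => ?_
  simp only [RCLike.ofReal_real_eq_id, id_eq, star_trivial]
  ring

/-- **The resolvent as a function of `T`**: for `T ≻ 0` and `x ≥ 0`,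
`(xI + T)⁻¹ = cfc (t ↦ (x + t)⁻¹) T`. [folklore] -/
theorem resolvent_eq_cfc (hT : T.PosDef) {x : ℝ} (hx : 0 ≤ x) :
    (x • (1 : Matrix n n ℝ) + T)⁻¹ = cfc (fun t : ℝ => (x + t)⁻¹) T := by
  have hT' : IsSelfAdjoint T := hT.1
  have hne : ∀ t ∈ spectrum ℝ T, x + t ≠ 0 := fun t ht =>
    (add_pos_of_nonneg_of_pos hx (spectrum_pos hT t ht)).ne'
  rw [cfc_inv (fun t : ℝ => x + t) T hne, cfc_const_add x (fun t : ℝ => t) T, cfc_id' ℝ T,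
    Algebra.algebraMap_eq_smul_one, Matrix.nonsing_inv_eq_ringInverse]

/-- **What `T^{−1/2}` means here**: the functional calculus `S := cfc (t ↦ t^{−1/2}) T` of a positive definite
`T` satisfies `S·S = T⁻¹` — i.e. `S` is a square root of `C^{(k)} = (C*Δ_kC)⁻¹` (its positivity, true, is not
proved or used in this file), the left-hand
side `(C^{(k)})^{1/2} = (C*Δ_kC)^{−1/2}` of (2.7). [folklore] -/
theorem invSqrt_mul_self (hT : T.PosDef) :
    cfc (fun t : ℝ => (Real.sqrt t)⁻¹) T * cfc (fun t : ℝ => (Real.sqrt t)⁻¹) T = T⁻¹ := by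
  have hT' : IsSelfAdjoint T := hT.1
  have hcont : ContinuousOn (fun t : ℝ => (Real.sqrt t)⁻¹) (spectrum ℝ T) :=
    Real.continuous_sqrt.continuousOn.inv₀ fun t ht => (Real.sqrt_pos.2 (spectrum_pos hT t ht)).ne'
  rw [← cfc_mul _ _ T hcont hcont]
  have h1 : cfc (fun t : ℝ => (Real.sqrt t)⁻¹ * (Real.sqrt t)⁻¹) T = cfc (fun t : ℝ => t⁻¹) T :=
    cfc_congr fun t ht => by
      rw [← mul_inv, Real.mul_self_sqrt (spectrum_pos hT t ht).le]
  have h2 := resolvent_eq_cfc hT le_rfl (T := T)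
  simp only [zero_smul, zero_add] at h2
  rw [h1, ← h2]

/-- **Entries of the resolvent**: `(xI + T)⁻¹_{ij} = Σ_k U_{ik} U_{jk} (x + λ_k)⁻¹` for `x ≥ 0`.
[folklore] -/
theorem resolvent_apply (hT : T.PosDef) {x : ℝ} (hx : 0 ≤ x) (i j : n) :
    (x • (1 : Matrix n n ℝ) + T)⁻¹ i j = ∑ k, (hT.1.eigenvectorUnitary : Matrix n n ℝ) i k *
      (hT.1.eigenvectorUnitary : Matrix n n ℝ) j k * (x + hT.1.eigenvalues k)⁻¹ := by
  rw [resolvent_eq_cfc hT hx, cfc_apply_eq hT.1]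

/-- The entrywise integrand of (2.7) on `x > 0` is the finite superposition of the scalar kernels
`k(λ_k, x)` with weights `U_{ik}U_{jk}`. [folklore] -/
theorem integrand_eq_sum (hT : T.PosDef) {x : ℝ} (hx : 0 < x) (i j : n) :
    (Real.sqrt x)⁻¹ * (x • (1 : Matrix n n ℝ) + T)⁻¹ i j =
      ∑ k, (hT.1.eigenvectorUnitary : Matrix n n ℝ) i k *
        (hT.1.eigenvectorUnitary : Matrix n n ℝ) j k * kernel (hT.1.eigenvalues k) x := by
  rw [resolvent_apply hT hx.le, Finset.mul_sum]
  refine Finset.sum_congr rfl fun k _ => ?_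
  rw [kernel]; ring

/-- The entrywise integrand of (2.7) is integrable on every `(γ, ∞)`, `γ ≥ 0`. [folklore] -/
theorem integrableOn_integrand (hT : T.PosDef) {γ : ℝ} (hγ : 0 ≤ γ) (i j : n) :
    IntegrableOn (fun x : ℝ => (Real.sqrt x)⁻¹ * (x • (1 : Matrix n n ℝ) + T)⁻¹ i j) (Ioi γ) := by
  have h : IntegrableOn (fun x : ℝ => ∑ k, (hT.1.eigenvectorUnitary : Matrix n n ℝ) i k *
      (hT.1.eigenvectorUnitary : Matrix n n ℝ) j k * kernel (hT.1.eigenvalues k) x) (Ioi γ) :=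
    integrable_finsetSum _ fun k _ =>
      (integrableOn_kernel_Ioi_of_nonneg (hT.eigenvalues_pos k) hγ).const_mul _
  refine h.congr_fun (fun x hx => (integrand_eq_sum hT (hγ.trans_lt hx) i j).symm) measurableSet_Ioi

/-- **(2.7), first identity, kernel-checked for a positive definite real symmetric matrix**
(the symmetric case `(U, 0)` of p. 15: *"For the pair (U,0) the operators are symmetric, and the
measure is positive"*): entrywise,
`(T^{−1/2})_{ij} = (1/π) ∫₀^∞ dx x^{−1/2} ((xI + T)⁻¹)_{ij}`, where `T^{−1/2} := cfc (t ↦ t^{−1/2}) T`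
is the functional calculus of Mathlib. [cite: Balaban1988RG2Cluster, (2.7) p.13] -/
theorem invSqrt_apply_eq_integral (hT : T.PosDef) (i j : n) :
    cfc (fun t : ℝ => (Real.sqrt t)⁻¹) T i j =
      π⁻¹ * ∫ x in Ioi (0 : ℝ), (Real.sqrt x)⁻¹ * (x • (1 : Matrix n n ℝ) + T)⁻¹ i j := by
  have hev : ∀ k, 0 < hT.1.eigenvalues k := hT.eigenvalues_pos
  rw [setIntegral_congr_fun measurableSet_Ioi (fun x hx => integrand_eq_sum hT hx i j),
    integral_finsetSum _ (fun k _ => (integrableOn_kernel_Ioi (hev k)).const_mul _),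
    cfc_apply_eq hT.1, Finset.mul_sum]
  refine Finset.sum_congr rfl fun k _ => ?_
  rw [integral_const_mul, integral_kernel_Ioi (hev k), div_eq_mul_inv]
  have hπ : (π : ℝ) ≠ 0 := Real.pi_ne_zero
  field_simp

/-- **Powers in the eigenbasis**: `(T^m)_{ij} = Σ_k U_{ik} U_{jk} λ_k^m`. [folklore] -/
theorem pow_apply_eq (hT : T.IsHermitian) (m : ℕ) (i j : n) :
    (T ^ m) i j = ∑ k, (hT.eigenvectorUnitary : Matrix n n ℝ) i k *
      (hT.eigenvectorUnitary : Matrix n n ℝ) j k * hT.eigenvalues k ^ m := by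
  have hT' : IsSelfAdjoint T := hT
  rw [← cfc_pow_id (R := ℝ) T m, cfc_apply_eq hT]

/-- **(2.7), the series**: for `γ₁` larger than every eigenvalue of `T ≻ 0` ("if γ₁ is sufficiently
large"), the entrywise tail `∫_{γ₁}^∞ dx x^{−1/2} ((xI + T)⁻¹)_{ij}` is the sum of the printed series
`Σ_m ((−1)^m/(m+½)) γ₁^{−m−½} (T^m)_{ij}` (WITHOUT the factor `1/π`, exactly as the tail integral
without it). [cite: Balaban1988RG2Cluster, (2.7) p.13] -/
theorem hasSum_series_apply (hT : T.PosDef) {γ₁ : ℝ} (hγ : ∀ k, hT.1.eigenvalues k < γ₁) (i j : n) :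
    HasSum (fun m : ℕ => (-1) ^ m / ((m : ℝ) + 1 / 2) * (γ₁ ^ m * Real.sqrt γ₁)⁻¹ * (T ^ m) i j)
      (∫ x in Ioi γ₁, (Real.sqrt x)⁻¹ * (x • (1 : Matrix n n ℝ) + T)⁻¹ i j) := by
  have hev : ∀ k, 0 < hT.1.eigenvalues k := hT.eigenvalues_pos
  have hγpos : 0 < γ₁ := (hev i).trans (hγ i)
  have hint : ∫ x in Ioi γ₁, (Real.sqrt x)⁻¹ * (x • (1 : Matrix n n ℝ) + T)⁻¹ i j
      = ∑ k, (hT.1.eigenvectorUnitary : Matrix n n ℝ) i k *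
          (hT.1.eigenvectorUnitary : Matrix n n ℝ) j k *
            ∫ x in Ioi γ₁, kernel (hT.1.eigenvalues k) x := by
    rw [setIntegral_congr_fun measurableSet_Ioi
        (fun x hx => integrand_eq_sum hT (hγpos.trans hx) i j),
      integral_finsetSum _
        (fun k _ => (integrableOn_kernel_Ioi_of_nonneg (hev k) hγpos.le).const_mul _)]
    refine Finset.sum_congr rfl fun k _ => ?_
    exact integral_const_mul _ _
  have hterm : (fun m : ℕ => (-1) ^ m / ((m : ℝ) + 1 / 2) * (γ₁ ^ m * Real.sqrt γ₁)⁻¹ * (T ^ m) i j)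
      = fun m => ∑ k, (hT.1.eigenvectorUnitary : Matrix n n ℝ) i k *
          (hT.1.eigenvectorUnitary : Matrix n n ℝ) j k * seriesTerm γ₁ (hT.1.eigenvalues k) m := by
    funext m
    rw [pow_apply_eq hT.1, Finset.mul_sum]
    refine Finset.sum_congr rfl fun k _ => ?_
    rw [seriesTerm]; ring
  rw [hint, hterm]
  exact hasSum_sum fun k _ => (hasSum_seriesTerm (hev k) (hγ k)).mul_left _

/-- **(2.7), both identities, kernel-checked entrywise for `T ≻ 0` with every eigenvalue `< γ₁`, the factor
`1/π` restored on the series**: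
`(T^{−1/2})_{ij} = (1/π)∫₀^{γ₁} dx x^{−1/2}((xI + T)⁻¹)_{ij} + (1/π)Σ_m ((−1)^m/(m+½)) γ₁^{−m−½}(T^m)_{ij}`.
[cite: Balaban1988RG2Cluster, (2.7) p.13] -/
theorem invSqrt_apply_eq_split (hT : T.PosDef) {γ₁ : ℝ} (hγ : ∀ k, hT.1.eigenvalues k < γ₁) (i j : n) :
    cfc (fun t : ℝ => (Real.sqrt t)⁻¹) T i j =
      π⁻¹ * (∫ x in Ioc 0 γ₁, (Real.sqrt x)⁻¹ * (x • (1 : Matrix n n ℝ) + T)⁻¹ i j) +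
      π⁻¹ * ∑' m : ℕ, (-1) ^ m / ((m : ℝ) + 1 / 2) * (γ₁ ^ m * Real.sqrt γ₁)⁻¹ * (T ^ m) i j := by
  have hγpos : 0 < γ₁ := (hT.eigenvalues_pos i).trans (hγ i)
  have hdisj : Disjoint (Ioc (0 : ℝ) γ₁) (Ioi γ₁) :=
    Set.disjoint_left.2 fun y hy hy' => not_lt.2 hy.2 hy'
  have h1 : IntegrableOn (fun x : ℝ => (Real.sqrt x)⁻¹ * (x • (1 : Matrix n n ℝ) + T)⁻¹ i j)
      (Ioc 0 γ₁) := (integrableOn_integrand hT le_rfl i j).mono_set Ioc_subset_Ioi_self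
  have hsplit := setIntegral_union hdisj measurableSet_Ioi h1 (integrableOn_integrand hT hγpos.le i j)
  rw [Ioc_union_Ioi_eq_Ioi hγpos.le] at hsplit
  rw [(hasSum_series_apply hT hγ i j).tsum_eq, invSqrt_apply_eq_integral hT i j, hsplit, mul_add]

/-- Every eigenvalue is bounded by any constant bounding the Rayleigh quotient:
`(∀ v, ⟨v, Tv⟩ ≤ c‖v‖²) → λ_k ≤ c`. [folklore] -/
theorem eigenvalues_le_of_form_le (hT : T.IsHermitian) {c : ℝ}
    (h : ∀ v : n → ℝ, v ⬝ᵥ (T *ᵥ v) ≤ c * (v ⬝ᵥ v)) (k : n) : hT.eigenvalues k ≤ c := by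
  have hu : (⇑(hT.eigenvectorBasis k) : n → ℝ) ⬝ᵥ ⇑(hT.eigenvectorBasis k) = 1 := by
    have h1 := hT.eigenvectorBasis.orthonormal.1 k
    rw [EuclideanSpace.norm_eq, Real.sqrt_eq_one] at h1
    simpa [dotProduct, pow_two] using h1
  rw [hT.eigenvalues_eq k, RCLike.re_to_real, star_trivial]
  calc _ ≤ c * _ := h _
    _ = c := by rw [hu, mul_one]

/-- **(2.7) under a form bound** ("if γ₁ is sufficiently large" = `γ₁ > c ≥ sup ⟨v,Tv⟩/‖v‖²`; the cell's
interface C-IF-07 (E2) supplies such a `c = γ₁(d, L)` for `T = C*Δ_kC`, kernel `B9SectEKernel.form_sandwich_le`).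
[cite: Balaban1988RG2Cluster, (2.7) p.13] -/
theorem invSqrt_apply_eq_split_of_form_le (hT : T.PosDef) {c γ₁ : ℝ}
    (hc : ∀ v : n → ℝ, v ⬝ᵥ (T *ᵥ v) ≤ c * (v ⬝ᵥ v)) (hcγ : c < γ₁) (i j : n) :
    cfc (fun t : ℝ => (Real.sqrt t)⁻¹) T i j =
      π⁻¹ * (∫ x in Ioc 0 γ₁, (Real.sqrt x)⁻¹ * (x • (1 : Matrix n n ℝ) + T)⁻¹ i j) +
      π⁻¹ * ∑' m : ℕ, (-1) ^ m / ((m : ℝ) + 1 / 2) * (γ₁ ^ m * Real.sqrt γ₁)⁻¹ * (T ^ m) i j :=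
  invSqrt_apply_eq_split hT (fun k => (eigenvalues_le_of_form_le hT.1 hc k).trans_lt hcγ) i j

end matrix

/-! ## §3. What (2.7) delivers for the kernel of `(C^{(k)})^{1/2}`: the sup-kernel half, from the tree's
`x`-uniform resolvent bounds (`B9SectEKernel`, cell GAPS C-IF-07) — no random-walk expansion needed here -/

section decay

variable {n : Type*} [Fintype n] [DecidableEq n] {T : Matrix n n ℝ}

/-- **Superposition bound.**  If the resolvent entry obeys `|((xI + T)⁻¹)_{ij}| ≤ K` (an `x`-UNIFORM bound)
and `≤ x⁻¹` (the trivial large-`x` bound) for all `x > 0`, then `|(T^{−1/2})_{ij}| ≤ 2√K`: indeed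
`min(K, x⁻¹) ≤ 2(x + K⁻¹)⁻¹`, and `(1/π)∫₀^∞ x^{−1/2}·2(x + K⁻¹)⁻¹ dx = 2√K` by §1. [folklore] -/
theorem abs_invSqrt_apply_le (hT : T.PosDef) (i j : n) {K : ℝ} (hK : 0 < K)
    (hunif : ∀ x : ℝ, 0 < x → |(x • (1 : Matrix n n ℝ) + T)⁻¹ i j| ≤ K)
    (hdec : ∀ x : ℝ, 0 < x → |(x • (1 : Matrix n n ℝ) + T)⁻¹ i j| ≤ x⁻¹) :
    |cfc (fun t : ℝ => (Real.sqrt t)⁻¹) T i j| ≤ 2 * Real.sqrt K := by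
  have hptw : ∀ x ∈ Ioi (0 : ℝ),
      ‖(Real.sqrt x)⁻¹ * (x • (1 : Matrix n n ℝ) + T)⁻¹ i j‖ ≤ 2 * kernel K⁻¹ x := by
    intro x hx
    have hx : 0 < x := hx
    rw [Real.norm_eq_abs, abs_mul, abs_of_nonneg (inv_nonneg.2 (Real.sqrt_nonneg x)), kernel,
      mul_left_comm]
    refine mul_le_mul_of_nonneg_left ?_ (inv_nonneg.2 (Real.sqrt_nonneg x))
    have hpos : 0 < x + K⁻¹ := by positivity
    rw [← div_eq_mul_inv, le_div_iff₀ hpos]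
    rcases le_total x K⁻¹ with hxK | hxK
    · have h := hunif x hx
      have h2 : |(x • (1 : Matrix n n ℝ) + T)⁻¹ i j| * (x + K⁻¹) ≤ K * (K⁻¹ + K⁻¹) :=
        mul_le_mul h (by linarith) hpos.le hK.le
      have hKK : K * (K⁻¹ + K⁻¹) = 2 := by field_simp; ring
      linarith
    · have h := hdec x hx
      have h2 : |(x • (1 : Matrix n n ℝ) + T)⁻¹ i j| * (x + K⁻¹) ≤ x⁻¹ * (x + x) :=
        mul_le_mul h (by linarith) hpos.le (inv_nonneg.2 hx.le)
      have hxx : x⁻¹ * (x + x) = 2 := by field_simp; ring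
      linarith
  have hK' : 0 < K⁻¹ := inv_pos.2 hK
  have hbound := norm_integral_le_of_norm_le ((integrableOn_kernel_Ioi hK').const_mul 2)
    (ae_restrict_of_forall_mem measurableSet_Ioi hptw)
  rw [integral_const_mul, integral_kernel_Ioi hK', Real.sqrt_inv, div_inv_eq_mul, Real.norm_eq_abs]
    at hbound
  have hπ : (0 : ℝ) < π⁻¹ := inv_pos.2 Real.pi_pos
  rw [invSqrt_apply_eq_integral hT i j, abs_mul, abs_of_pos hπ]
  calc π⁻¹ * |∫ x in Ioi (0 : ℝ), (Real.sqrt x)⁻¹ * (x • (1 : Matrix n n ℝ) + T)⁻¹ i j|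
      ≤ π⁻¹ * (2 * (π * Real.sqrt K)) := mul_le_mul_of_nonneg_left hbound hπ.le
    _ = 2 * Real.sqrt K := by
        have hπ0 : (π : ℝ) ≠ 0 := Real.pi_ne_zero
        field_simp

/-- **Decay of the square-root kernel** under the hypotheses of the tree's
`B9SectEKernel.resolvent_decay_uniform` (coercivity constant `γ`, a pseudo-metric `d`, and `(e^{κd} − 1)`-weighted
absolute row/column sums `≤ ρ < γ`) plus `T.IsHermitian` (needed for `cfc`):
`|(T^{−1/2})_{ij}| ≤ 2·√((γ − ρ)⁻¹ e^{−κ d(i,j)})`.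
The `x`-uniform bound is `resolvent_decay_uniform`, the large-`x` bound is `QGQInverse.inv_entry_le_of_coercive`
for `T + x·1` (coercivity `γ + x ≥ x`, `B9SectEKernel.coercive_add_smul_one`).  This is the sup-kernel half of
what (2.7) is used for (localisation of `(C^{(k)})^{1/2}`, cell GAPS G-B13-05 (a) / C-IF-07); the random-walk half
stays the located residual G-IF-10. [folklore] -/
theorem abs_invSqrt_apply_le_of_decay (hTs : T.IsHermitian) (d : n → n → ℝ) {γ κ ρ : ℝ}
    (hργ : ρ < γ) (hκ : 0 ≤ κ) (hc : QGQInverse.Coercive T γ)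
    (hd_symm : ∀ i j, d i j = d j i) (hd_zero : ∀ i, d i i = 0)
    (hd_tri : ∀ i j k, d i k ≤ d i j + d j k)
    (hrow : ∀ i, ∑ j, |T i j| * (Real.exp (κ * d i j) - 1) ≤ ρ)
    (hcol : ∀ j, ∑ i, |T i j| * (Real.exp (κ * d i j) - 1) ≤ ρ) (i j : n) :
    |cfc (fun t : ℝ => (Real.sqrt t)⁻¹) T i j|
      ≤ 2 * Real.sqrt ((γ - ρ)⁻¹ * Real.exp (-(κ * d i j))) := by
  have hd_nonneg : ∀ a b, 0 ≤ d a b := fun a b => by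
    have h := hd_tri a b a
    rw [hd_zero, hd_symm b a] at h
    linarith
  have hρ0 : 0 ≤ ρ := (Finset.sum_nonneg fun k _ => mul_nonneg (abs_nonneg _)
    (sub_nonneg.2 (Real.one_le_exp (mul_nonneg hκ (hd_nonneg i k))))).trans (hrow i)
  have hγ : 0 < γ := hρ0.trans_lt hργ
  have hT : T.PosDef := posDef_of_coercive hTs hγ hc
  refine abs_invSqrt_apply_le hT i j (mul_pos (inv_pos.2 (sub_pos.2 hργ)) (Real.exp_pos _)) ?_ ?_
  · intro x hx
    have h := B9SectEKernel.resolvent_decay_uniform T d hργ hκ hc hd_symm hd_zero hd_tri hrow hcol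
      hx.le i j
    rwa [add_comm T] at h
  · intro x hx
    have h := QGQInverse.inv_entry_le_of_coercive (S := T + x • (1 : Matrix n n ℝ))
      (show 0 < γ + x by linarith) (B9SectEKernel.coercive_add_smul_one hc x) i j
    rw [add_comm T] at h
    exact h.trans (inv_anti₀ hx (by linarith))

/-- The same bound written with the halved rate: `|(T^{−1/2})_{ij}| ≤ 2(γ − ρ)^{−1/2} e^{−κ d(i,j)/2}` — the
square root of the covariance inherits HALF the decay rate of the resolvent family. [folklore] -/
theorem abs_invSqrt_apply_le_of_decay_exp (hTs : T.IsHermitian) (d : n → n → ℝ) {γ κ ρ : ℝ}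
    (hργ : ρ < γ) (hκ : 0 ≤ κ) (hc : QGQInverse.Coercive T γ)
    (hd_symm : ∀ i j, d i j = d j i) (hd_zero : ∀ i, d i i = 0)
    (hd_tri : ∀ i j k, d i k ≤ d i j + d j k)
    (hrow : ∀ i, ∑ j, |T i j| * (Real.exp (κ * d i j) - 1) ≤ ρ)
    (hcol : ∀ j, ∑ i, |T i j| * (Real.exp (κ * d i j) - 1) ≤ ρ) (i j : n) :
    |cfc (fun t : ℝ => (Real.sqrt t)⁻¹) T i j|
      ≤ 2 * (Real.sqrt (γ - ρ))⁻¹ * Real.exp (-(κ * d i j / 2)) := by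
  have h := abs_invSqrt_apply_le_of_decay hTs d hργ hκ hc hd_symm hd_zero hd_tri hrow hcol i j
  rw [Real.sqrt_mul (inv_nonneg.2 (sub_pos.2 hργ).le), Real.sqrt_inv, ← Real.exp_half,
    ← mul_assoc] at h
  convert h using 3
  ring

end decay


/-! ## §4. The series part of (2.7) is exponentially localised at the FULL rate (v2, gen 4):
*"Expanding the operator Δ_k into the generalized random walks, we obtain an expansion of the series above, if γ₁
is sufficiently large"* — at the level of kernels: if the `e^{κd}`-weighted absolute row sums of `T` are `≤ ρ`
(pseudo-metric `d`, `κ ≥ 0`), then `|(T^m)_{ij}| ≤ ρ^m e^{−κ d(i,j)}` (the weighted row norm is submultiplicative),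
so for `γ₁ > ρ` the series `Σ_m ((−1)^m/(m+½)) γ₁^{−m−½}(T^m)_{ij}` is dominated by a geometric series and its sum
is `≤ 2γ₁^{−1/2}(1 − ρ/γ₁)^{−1} e^{−κ d(i,j)}` — "γ₁ sufficiently large" in its second precise meaning `γ₁ > ρ`
(`≥ λ_max`).  Elementary; no random-walk expansion and no positivity needed for this part. -/

section seriesLocal

variable {n : Type*} [Fintype n] [DecidableEq n]

/-- **Submultiplicativity of the weighted row norm, iterated**: if `Σ_j |T_{ij}| e^{κ d(i,j)} ≤ ρ` for every `i`
(pseudo-metric `d`, `κ ≥ 0`), then `Σ_j |(T^m)_{ij}| e^{κ d(i,j)} ≤ ρ^m` for every `m` and `i`. [folklore] -/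
theorem weightedRowSum_pow_le (T : Matrix n n ℝ) (d : n → n → ℝ) {κ ρ : ℝ} (hκ : 0 ≤ κ)
    (hd_zero : ∀ i, d i i = 0) (hd_tri : ∀ i j k, d i k ≤ d i j + d j k)
    (hrow : ∀ i, ∑ j, |T i j| * Real.exp (κ * d i j) ≤ ρ) (m : ℕ) (i : n) :
    ∑ j, |(T ^ m) i j| * Real.exp (κ * d i j) ≤ ρ ^ m := by
  have hρ : 0 ≤ ρ := (Finset.sum_nonneg fun j _ => mul_nonneg (abs_nonneg _) (Real.exp_pos _).le).trans (hrow i)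
  induction m generalizing i with
  | zero =>
    rw [pow_zero, pow_zero, Finset.sum_eq_single i (fun j _ hji => by rw [Matrix.one_apply_ne' hji]; simp)
      (fun h => (h (Finset.mem_univ i)).elim), Matrix.one_apply_eq, hd_zero, mul_zero, Real.exp_zero, abs_one,
      mul_one]
  | succ m ih =>
    have hexp : ∀ l j, Real.exp (κ * d i j) ≤ Real.exp (κ * d i l) * Real.exp (κ * d l j) := fun l j => by
      rw [← Real.exp_add]
      exact Real.exp_le_exp.2 (by nlinarith [hd_tri i l j])
    calc ∑ j, |(T ^ (m + 1)) i j| * Real.exp (κ * d i j)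
        = ∑ j, |∑ l, (T ^ m) i l * T l j| * Real.exp (κ * d i j) := by
          simp only [pow_succ, Matrix.mul_apply]
      _ ≤ ∑ j, ∑ l, |(T ^ m) i l| * Real.exp (κ * d i l) * (|T l j| * Real.exp (κ * d l j)) := by
          refine Finset.sum_le_sum fun j _ => ?_
          calc |∑ l, (T ^ m) i l * T l j| * Real.exp (κ * d i j)
              ≤ (∑ l, |(T ^ m) i l| * |T l j|) * Real.exp (κ * d i j) := by
                refine mul_le_mul_of_nonneg_right ?_ (Real.exp_pos _).le
                exact (Finset.abs_sum_le_sum_abs _ _).trans (le_of_eq (Finset.sum_congr rfl fun l _ => abs_mul _ _))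
            _ = ∑ l, |(T ^ m) i l| * |T l j| * Real.exp (κ * d i j) := Finset.sum_mul _ _ _
            _ ≤ ∑ l, |(T ^ m) i l| * Real.exp (κ * d i l) * (|T l j| * Real.exp (κ * d l j)) :=
                Finset.sum_le_sum fun l _ => by
                  calc |(T ^ m) i l| * |T l j| * Real.exp (κ * d i j)
                      ≤ |(T ^ m) i l| * |T l j| * (Real.exp (κ * d i l) * Real.exp (κ * d l j)) :=
                        mul_le_mul_of_nonneg_left (hexp l j) (by positivity)
                    _ = _ := by ring
      _ = ∑ l, |(T ^ m) i l| * Real.exp (κ * d i l) * ∑ j, |T l j| * Real.exp (κ * d l j) := by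
          rw [Finset.sum_comm]
          exact Finset.sum_congr rfl fun l _ => (Finset.mul_sum _ _ _).symm
      _ ≤ ∑ l, |(T ^ m) i l| * Real.exp (κ * d i l) * ρ :=
          Finset.sum_le_sum fun l _ => mul_le_mul_of_nonneg_left (hrow l) (by positivity)
      _ = (∑ l, |(T ^ m) i l| * Real.exp (κ * d i l)) * ρ := (Finset.sum_mul _ _ _).symm
      _ ≤ ρ ^ m * ρ := mul_le_mul_of_nonneg_right (ih i) hρ
      _ = ρ ^ (m + 1) := (pow_succ ρ m).symm

/-- **Powers of an exponentially localised operator are exponentially localised at the same rate**: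
`|(T^m)_{ij}| ≤ ρ^m e^{−κ d(i,j)}` under the weighted-row-sum hypothesis. [folklore] -/
theorem abs_pow_apply_le_of_weightedRowSum (T : Matrix n n ℝ) (d : n → n → ℝ) {κ ρ : ℝ} (hκ : 0 ≤ κ)
    (hd_zero : ∀ i, d i i = 0) (hd_tri : ∀ i j k, d i k ≤ d i j + d j k)
    (hrow : ∀ i, ∑ j, |T i j| * Real.exp (κ * d i j) ≤ ρ) (m : ℕ) (i j : n) :
    |(T ^ m) i j| ≤ ρ ^ m * Real.exp (-(κ * d i j)) := by
  have h1 : |(T ^ m) i j| * Real.exp (κ * d i j) ≤ ρ ^ m :=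
    (Finset.single_le_sum (f := fun j => |(T ^ m) i j| * Real.exp (κ * d i j))
      (fun j _ => mul_nonneg (abs_nonneg _) (Real.exp_pos _).le) (Finset.mem_univ j)).trans
      (weightedRowSum_pow_le T d hκ hd_zero hd_tri hrow m i)
  rw [Real.exp_neg, ← div_eq_mul_inv, le_div_iff₀ (Real.exp_pos _)]
  exact h1

/-- **The series part of (2.7) is localised at the full rate `κ`** ("if γ₁ is sufficiently large" = `γ₁ > ρ`):
`|Σ_m ((−1)^m/(m+½)) γ₁^{−m−½}(T^m)_{ij}| ≤ 2γ₁^{−1/2}(1 − ρ/γ₁)^{−1} e^{−κ d(i,j)}`.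
[cite: Balaban1988RG2Cluster, (2.7) p.13] -/
theorem abs_series_apply_le (T : Matrix n n ℝ) (d : n → n → ℝ) {κ ρ γ₁ : ℝ} (hκ : 0 ≤ κ)
    (hd_zero : ∀ i, d i i = 0) (hd_tri : ∀ i j k, d i k ≤ d i j + d j k)
    (hrow : ∀ i, ∑ j, |T i j| * Real.exp (κ * d i j) ≤ ρ) (hργ : ρ < γ₁) (i j : n) :
    |∑' m : ℕ, (-1) ^ m / ((m : ℝ) + 1 / 2) * (γ₁ ^ m * Real.sqrt γ₁)⁻¹ * (T ^ m) i j|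
      ≤ 2 * (Real.sqrt γ₁)⁻¹ * (1 - ρ / γ₁)⁻¹ * Real.exp (-(κ * d i j)) := by
  have hρ : 0 ≤ ρ := (Finset.sum_nonneg fun j _ => mul_nonneg (abs_nonneg _) (Real.exp_pos _).le).trans (hrow i)
  have hγ : 0 < γ₁ := hρ.trans_lt hργ
  have hq0 : 0 ≤ ρ / γ₁ := div_nonneg hρ hγ.le
  have hq1 : ρ / γ₁ < 1 := (div_lt_one hγ).2 hργ
  have hgeom := ((hasSum_geometric_of_lt_one hq0 hq1).mul_left
    (2 * (Real.sqrt γ₁)⁻¹ * Real.exp (-(κ * d i j))))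
  have hval : 2 * (Real.sqrt γ₁)⁻¹ * Real.exp (-(κ * d i j)) * (1 - ρ / γ₁)⁻¹
      = 2 * (Real.sqrt γ₁)⁻¹ * (1 - ρ / γ₁)⁻¹ * Real.exp (-(κ * d i j)) := by ring
  rw [hval] at hgeom
  rw [← Real.norm_eq_abs]
  refine tsum_of_norm_bounded hgeom fun m => ?_
  rw [Real.norm_eq_abs, abs_mul, abs_mul, abs_div, abs_pow, abs_neg, abs_one, one_pow,
    abs_of_pos (by positivity : (0 : ℝ) < (m : ℝ) + 1 / 2),
    abs_of_pos (by positivity : (0 : ℝ) < (γ₁ ^ m * Real.sqrt γ₁)⁻¹)]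
  have hT := abs_pow_apply_le_of_weightedRowSum T d hκ hd_zero hd_tri hrow m i j
  have hm : 1 / ((m : ℝ) + 1 / 2) ≤ 2 := by
    rw [div_le_iff₀ (by positivity)]
    have : (0 : ℝ) ≤ m := Nat.cast_nonneg m
    linarith
  have hsγ : 0 < Real.sqrt γ₁ := Real.sqrt_pos.2 hγ
  calc 1 / ((m : ℝ) + 1 / 2) * (γ₁ ^ m * Real.sqrt γ₁)⁻¹ * |(T ^ m) i j|
      ≤ 2 * (γ₁ ^ m * Real.sqrt γ₁)⁻¹ * (ρ ^ m * Real.exp (-(κ * d i j))) :=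
        mul_le_mul (mul_le_mul_of_nonneg_right hm (by positivity)) hT (abs_nonneg _) (by positivity)
    _ = 2 * (Real.sqrt γ₁)⁻¹ * Real.exp (-(κ * d i j)) * (ρ / γ₁) ^ m := by
        rw [div_pow, mul_inv]
        field_simp
    _ = _ := rfl

end seriesLocal

end Literature.MathematicalPhysics.QuantumFieldTheory.Balaban1983to89.B13Sqrt27

end
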